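import Mathlib
import HarnessLib
import Summits.CriticalPhenomena.CardyFormulaZ2.Theses.CardySelfDualSegment
import Literature.Probability.Percolation.CornerPercolation

/-!
# Sketch — crux SegmentOpen (stmt-CriticalPhenomena-5471), crux-ideate round 1, ideator 1

First lemmas of the two idea cards, stated over existing declarations
(`Percolation.cornerCrossingProb`, `cornerPercolation`, `BoxCrossingBounds`, `moduliShear`, route decl
`SegmentOpen`). Nothing here is filed; provability annotations are in the docstrings.
-/

noncomputable section

namespace Summit.CriticalPhenomena.CardyFormulaZ2.Cruxes.SegmentOpen.Sketch

open Literature.Probability Literature.Barriers.CriticalPhenomena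
open Literature.Probability.RandomPlanarGeometry (ConformalRectangle ConformalEquiv)
open Filter Set Topology

/-- `CardyMod t α` of the route, over the library's `Percolation.cornerCrossingProb` (= the route's `P`). -/
def CardyModAt (t : unitInterval) (α : ℂ) : Prop :=
  ∀ (R R' : ConformalRectangle)
    (φ : ConformalEquiv UpperHalfPlane.upperHalfPlaneSet R.carrier) (x : Fin 4 → ℝ),
    R.carrier = moduliShear α '' R'.carrier → (∀ i, R.pt i = moduliShear α (R'.pt i)) →
    R.IsUniformizing φ x →
    Tendsto (Percolation.cornerCrossingProb t R') (𝓝[>] 0) (𝓝 (RandomPlanarGeometry.cardyFunction (RandomPlanarGeometry.crossRatio x)))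

/-- The route's good set `G`. -/
def goodSet : Set unitInterval := {t | ∃ α : ℂ, 0 < α.im ∧ CardyModAt t α}

/-- The route's UniformMarginality body (hypothesis of `SegmentOpen`). -/
def UM : Prop :=
  ∀ (t₀ : unitInterval) (R : ConformalRectangle) (ε : ℝ), 0 < ε → ∃ η > 0, ∀ t : unitInterval,
    dist t t₀ < η → ∀ δ : ℝ, 0 < δ → |Percolation.cornerCrossingProb t R δ - Percolation.cornerCrossingProb t₀ R δ| < ε

/-! ## Card A — RG-orbit rigidity near the Cardy manifold (UM = confinement) -/

/-- CONFINEMENT of `M_t` in the `ε`-neighbourhood of the Cardy functional of modulus `α₀`: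
every crude crossing probability is, eventually in the mesh, `ε`-close to the sheared Cardy value.
Because `P_t(λ R' + z, δ) = P_t(R', δ/λ)` for lattice translations, this is closeness AT ALL SCALES:
the whole forward scaling orbit of `M_t` stays in the `ε`-ball (dynamical reading of the card). -/
def Confined (t : unitInterval) (α₀ : ℂ) (ε : ℝ) : Prop :=
  ∀ (R R' : ConformalRectangle)
    (φ : ConformalEquiv UpperHalfPlane.upperHalfPlaneSet R.carrier) (x : Fin 4 → ℝ),
    R.carrier = moduliShear α₀ '' R'.carrier → (∀ i, R.pt i = moduliShear α₀ (R'.pt i)) →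
    R.IsUniformizing φ x →
    ∃ δ₀ > 0, ∀ δ ∈ Ioo 0 δ₀, |Percolation.cornerCrossingProb t R' δ - RandomPlanarGeometry.cardyFunction (RandomPlanarGeometry.crossRatio x)| < ε

/-- UNIFORM CONFINEMENT near a Cardy point: `η` uniform over all conformal rectangles.
(From UM, which is pointwise in `R`, this needs the local uniform RSW lemma below plus
RSW-equicontinuity of crossing probabilities in the shape of the quad — percolation technology,
M/L-sized.) -/
def UniformlyConfinedNear (t₀ : unitInterval) (α₀ : ℂ) : Prop :=
  ∀ ε > 0, ∃ η > 0, ∀ t : unitInterval, dist t t₀ < η → Confined t α₀ ε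

/-- ORBIT RIGIDITY of the Cardy manifold at `α₀` (the card's crux-within-the-crux, continuum
dynamics): there is `ε₀ > 0` such that every `M_t` confined in the `ε₀`-neighbourhood of the
modulus-`α₀` Cardy functional has EXACT Cardy limits for SOME modulus `α` ("a compact
scaling-invariant set of percolation noises inside an `ε₀`-neighbourhood of the normally hyperbolic
manifold of Cardy equilibria lies on it, and orbits have an asymptotic phase"). -/
def OrbitRigidity (α₀ : ℂ) : Prop :=
  ∃ ε₀ > 0, ∀ t : unitInterval, Confined t α₀ ε₀ → t ∈ goodSet

/-- Reduction (pure logic, provable now): uniform confinement near every Cardy point plus orbit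
rigidity of every Cardy manifold point give openness of `G`. -/
theorem isOpen_goodSet_of_rigidity
    (hUC : ∀ (t₀ : unitInterval) (α₀ : ℂ), 0 < α₀.im → CardyModAt t₀ α₀ →
      UniformlyConfinedNear t₀ α₀)
    (hR : ∀ (t₀ : unitInterval) (α₀ : ℂ), 0 < α₀.im → CardyModAt t₀ α₀ → OrbitRigidity α₀) :
    IsOpen goodSet := by
  rw [Metric.isOpen_iff]
  rintro t₀ ⟨α₀, hα₀, h₀⟩
  obtain ⟨ε₀, hε₀, hrig⟩ := hR t₀ α₀ hα₀ h₀
  obtain ⟨η, hη, hconf⟩ := hUC t₀ α₀ hα₀ h₀ ε₀ hε₀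
  refine ⟨η, hη, fun t ht => hrig t (hconf t ?_)⟩
  simpa [Metric.mem_ball] using ht

/-- First lemma of card A (provable now up to event plumbing, M-sized): UM and a Cardy point
`(t₀, α₀)` give box-crossing (RSW) bounds for `M_t`, UNIFORM in `t` near `t₀`, by the exact
scaling identity `P_t([0,ρ]×[0,1], 1/n) = P_t([0,ρ n]×[0,n], 1)`: the threshold mesh `δ₀` of the
Cardy convergence at `t₀` becomes the RSW scale `n₀ = ⌈1/δ₀⌉`, and `c = Cardy value − ε`. This is
also the local (near `G`) case of the sibling crux UniformBoxCrossing. -/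
def LocalUniformRSW : Prop :=
  UM → ∀ (t₀ : unitInterval) (α₀ : ℂ), 0 < α₀.im → CardyModAt t₀ α₀ →
    ∀ ρ : ℝ, 0 < ρ → ∃ c > 0, ∃ n₀ : ℕ, ∃ η > 0, ∀ t : unitInterval, dist t t₀ < η →
      LatticeModels.BoxCrossingBounds (Percolation.cornerPercolation t) LatticeModels.squareLatticeEmbedding.z ρ c n₀

/-! ## Card B — analytic continuation in the freeing parameter `t` -/

/-- For fixed `R, δ` the crude crossing probability is a polynomial in `t` (the event is a cylinder
event on the finitely many vertices drawn inside the bounded carrier; each enters through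
`Bernoulli(1/2) ⊗ Bernoulli(t/2)`). Provable now (M). -/
def CrossingProbPolynomial : Prop :=
  ∀ (R : ConformalRectangle) (δ : ℝ), 0 < δ →
    ∃ p : Polynomial ℝ, ∀ t : unitInterval, Percolation.cornerCrossingProb t R δ = p.eval (t : ℝ)

/-- UNIFORM ANALYTICITY near `t₀` (the card's hard analytic input = Gevrey/Lee–Yang-type bound
"all-orders marginality": `sup_δ |∂_t^k P_t(R,δ)| ≤ C k! r^{-k}`): the polynomials
`t ↦ P_t(R, δ)` extend to holomorphic functions on ONE complex disc around `t₀`, bounded by ONE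
constant, for all meshes `δ` (and all `R`). -/
def UniformlyAnalyticNear (t₀ : unitInterval) : Prop :=
  ∃ r > 0, ∃ C : ℝ, ∀ (R : ConformalRectangle) (δ : ℝ), 0 < δ →
    ∃ f : ℂ → ℂ, DifferentiableOn ℂ f (Metric.ball ((t₀ : ℝ) : ℂ) r) ∧
      (∀ z ∈ Metric.ball ((t₀ : ℝ) : ℂ) r, ‖f z‖ ≤ C) ∧
      ∀ t : unitInterval, dist t t₀ < r → f ((t : ℝ) : ℂ) = Percolation.cornerCrossingProb t R δ

/-- First lemma of card B — VITALI TRANSFER ("no wandering modulus, for free"): under uniform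
analyticity near `t₀`, if the crossing probabilities of `R` converge (as `δ → 0⁺`) at a sequence of
parameters `t_n → t₀`, `t_n ≠ t₀`, then they converge at EVERY parameter in a neighbourhood of
`t₀`, and the limit is real-analytic in `t`. Mechanism: Vitali–Porter / identity theorem for the
normal family `{P_·(R, δ)}_δ`. Provable from Mathlib's identity theorem
(`AnalyticOnNhd.eqOn_of_preconnected_of_frequently_eq`) plus a Montel/Arzelà–Ascoli step (L). -/
def VitaliTransfer : Prop :=
  ∀ (t₀ : unitInterval) (R : ConformalRectangle), UniformlyAnalyticNear t₀ →
    (∃ u : ℕ → unitInterval, Tendsto u atTop (𝓝 t₀) ∧ (∀ n, u n ≠ t₀) ∧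
      ∀ n, ∃ L : ℝ, Tendsto (Percolation.cornerCrossingProb (u n) R) (𝓝[>] 0) (𝓝 L)) →
    ∃ r > 0, ∃ g : ℝ → ℝ, AnalyticOnNhd ℝ g (Metric.ball (t₀ : ℝ) r) ∧
      ∀ t : unitInterval, dist t t₀ < r →
        Tendsto (Percolation.cornerCrossingProb t R) (𝓝[>] 0) (𝓝 (g t))

/-- ACCUMULATION ⇒ INTERIOR (card B, second lemma; uses VitaliTransfer for every `R`, strict
monotonicity of `θ ↦ Cardy(η(φ_{e^{iθ}} Q))` for one test quad `Q` and real-analyticity of that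
map — Ahlfors–Bers): under uniform analyticity and an RSW bound at `t₀` for ONE non-square box
(so that the moduli of the approximating Cardy points cannot degenerate to `∂ℍ`; near `G` this is
`LocalUniformRSW`, globally the sibling crux UniformBoxCrossing), every accumulation point of `G`
is an interior point of `G`. Consequently `IsOpen G ↔ G has no isolated points`. -/
def AccumulationInterior : Prop :=
  ∀ t₀ : unitInterval, UniformlyAnalyticNear t₀ →
    (∃ c > 0, ∃ n₀ : ℕ, LatticeModels.BoxCrossingBounds (Percolation.cornerPercolation t₀) LatticeModels.squareLatticeEmbedding.z 2 c n₀) →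
    AccPt t₀ (𝓟 goodSet) → t₀ ∈ interior goodSet

/-- Pure topology (provable now): a closed subset of `[0,1]` all of whose accumulation points are
interior points, and which accumulates at `0`, is everything. With `AccumulationInterior`, the
sibling crux SegmentClosed (G closed) and non-isolation of the Smirnov point `0 ∈ G`, this gives
`G = [0,1]`, hence `IsOpen G`: the whole crux is transferred to ALL-ORDERS PERTURBATION THEORY AT
THE SMIRNOV POINT plus uniform analyticity. -/
theorem eq_univ_of_isClosed_of_accPt {G : Set unitInterval} (hc : IsClosed G)
    (hacc : ∀ t ∈ G, AccPt t (𝓟 G) → t ∈ interior G) (h0 : AccPt (0 : unitInterval) (𝓟 G)) :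
    G = univ := by
  classical
  -- a closed set contains its accumulation points
  have hmemG : ∀ t, AccPt t (𝓟 G) → t ∈ G := fun t ht => by
    have hfr := accPt_iff_frequently.1 ht
    have : t ∈ closure G := mem_closure_iff_frequently.2 (hfr.mono fun _ h => h.2)
    simpa [hc.closure_eq] using this
  set I : Set unitInterval := interior G with hI
  have hIopen : IsOpen I := isOpen_interior
  -- I is closed: boundary points of I are accumulation points of G, hence interior points
  have hIclosed : IsClosed I := by
    rw [← closure_subset_iff_isClosed]
    intro b hb
    by_cases hbI : b ∈ I
    · exact hbI
    · have hfrI : ∃ᶠ y in 𝓝 b, y ∈ I := mem_closure_iff_frequently.1 hb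
      have haccI : AccPt b (𝓟 I) := by
        rw [accPt_iff_frequently]
        exact hfrI.mono fun y hy => ⟨fun h => hbI (h ▸ hy), hy⟩
      have haccG : AccPt b (𝓟 G) := haccI.mono (principal_mono.2 interior_subset)
      exact hacc b (hmemG b haccG) haccG
  have h0I : (0 : unitInterval) ∈ I := hacc 0 (hmemG 0 h0) h0
  haveI : PreconnectedSpace unitInterval := Subtype.preconnectedSpace isPreconnected_Icc
  have hIuniv : I = univ := IsClopen.eq_univ ⟨hIclosed, hIopen⟩ ⟨0, h0I⟩
  exact eq_univ_of_univ_subset (hIuniv ▸ interior_subset)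

/-- Composition shape of card B's line (logic only): -/
theorem isOpen_goodSet_of_analytic
    (hUA : ∀ t₀ : unitInterval, UniformlyAnalyticNear t₀)
    (hAI : AccumulationInterior)
    (hRSW : ∀ t₀ ∈ goodSet, ∃ c > 0, ∃ n₀ : ℕ,
      LatticeModels.BoxCrossingBounds (Percolation.cornerPercolation t₀) LatticeModels.squareLatticeEmbedding.z 2 c n₀)
    (hNoIso : ∀ t₀ ∈ goodSet, AccPt t₀ (𝓟 goodSet)) : IsOpen goodSet := by
  rw [← subset_interior_iff_isOpen]
  intro t ht
  exact hAI t (hUA t) (hRSW t ht) (hNoIso t ht)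

/-! ## Bridge to the route decl -/

/-- The route's `SegmentOpen` unfolds (zeta/delta) to `UM → IsOpen goodSet`. -/
theorem segmentOpen_iff :
    Summit.CriticalPhenomena.CardyFormulaZ2.Theses.CardySelfDualSegment.SegmentOpen ↔ (UM → IsOpen goodSet) := Iff.rfl

end Summit.CriticalPhenomena.CardyFormulaZ2.Cruxes.SegmentOpen.Sketch
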